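/-
Copyright (c) 2026 the pub-hodgecm-mathlib formalisation cell (harness21).  Prover seat hodgecm-mathlib-K2E3-p12 (g3), Track B «K2-LIT» ∕ h413
(`stmt-HodgeConjecture-24833`), line `K2_E3_EllipticInputs`, unit U12-d «Harish-Chandra characters», row 12: THE POINT-SUPPORTED PART OF THE
LIE-ALGEBRA CORE (L-B_GL) «Thm. 4.4 ∕ §21 for `J(𝒩)` on `𝔤𝔩_N(F)`» — every `N` — and (L-B_GL) OUTRIGHT IN RANK `N = 1`.  2026-09-04.
-/
import Literature.NumberTheory.Automorphic.LocalPiSchwartzBruhatFourier                      -- ★ `piFourierSB_mem_schwartzBruhat` (Weil VII §2 Prop. 2 on `F^ι`), boxes, `primePowBall` kit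
import Literature.NumberTheory.Rogawski1990.RankOneEulerPoincareGlue                        -- ★ `IsLocSmooth.sub`, `IsLocSmooth.const_smul` (+ `.add`, `isLocSmooth_indicator`)
import Summits.HodgeConjecture.HodgeConjecture.Theorems.K2E3NormalizedCharBddNearSemisimpleRegular  -- ★ p855019 (K2E3-p12 g0): `continuous_discr_charpoly`; ★ `LocalFieldHaar.continuous_normAbs`
import Mathlib.Topology.Instances.Matrix
import HarnessLib

/-!
# K2_E3 road (h413), unit U12-d on the Lie algebra `𝔤𝔩_N(F)` — THE `δ₀`-PART OF (L-B_GL), and (L-B_GL) in rank `1`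

Cell `pub/hodgecm-mathlib` (D-0151), Track B (21-frontier RULING «PUSH BOTH» 2026-09-03, director req624), seat K2E3-p12 (g3), lineage of row 12.
`--supports stmt-HodgeConjecture-24833 --as helper`; THEOREMS ONLY (no definition ∕ instance ∕ notation ∕ named fact ∕ `sorry`); never imports `Cruxes/…/Lines`.

After ★ p856314 (`K2E3NormalizedCharBddOnCayleySliceOfLieCore`) socket U12-d₁ — the minimal cone of tier-0 `stub_charLocBdd` — costs exactly (U12-g) + four
LIE-ALGEBRA CORE statements + (12-D); on `𝔤 = 𝔤𝔩_N(F)` (`F` a non-archimedean local field) the core (L-B_GL) is Harish-Chandra's Thm. 4.4 ∕ §21 for the space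
`J(𝒩)` of INVARIANT DISTRIBUTIONS SUPPORTED IN THE NILPOTENT CONE: every `T ∈ J(𝒩)` (a functional on `C_c^∞(𝔤)` = ★ `IsLocSmooth`, additive, homogeneous,
`Ad(GL_N)`-invariant, `T f = 0` when `supp f` misses the nilpotent matrices) has a Fourier transform `T̂ = F_T` (for `𝓕f(Y) = ∫ ψ(tr(YX)) f(X) dμ𝔤`,
[HarishChandra1999, §4 p. 11]) which is a locally integrable FUNCTION, locally constant on the regular set, with `√|disc χ_X|_F·|F_T(X)|` bounded on compacta
[HarishChandra1999, Thm. 4.4 p. 11 (1)–(3), §21 p. 87].  `J(𝒩)` is spanned by the nilpotent orbital integrals `μ_𝒪` [HarishChandra1999, Thm. 3.9 ∕ Cor. 3.10;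
Howe1974, Prop. 3]; the orbit `𝒪 = {0}` contributes `μ_{0} = δ₀` with `δ̂₀ = 1`, and in rank `N = 1` (`𝔤 = F`, `𝒩 = {0}`) it is ALL of `J(𝒩)`.  This file proves,
with no new definition:

* §1 **`isLocSmooth_matrixFourier`** — the Fourier transform `𝓕f(Y) = ∫ ψ(tr(YX)) f(X) dμ𝔤` of `f ∈ C_c^∞(𝔤𝔩_N(F))` is again in `C_c^∞(𝔤𝔩_N(F))`, for `ψ`
  continuous non-trivial and ANY left-invariant `μ𝔤` [WeilBNT1967, Ch. VII §2, Prop. 2; Weil1964 n° 11] — transported from ★ `piFourierSB_mem_schwartzBruhat` on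
  `F^{N×N}` along `X ↦ (X_{ij})_{(i,j)}` (`tr(YX) = ⟨vec X, vec Yᵀ⟩`); `matrixFourier_apply_zero`: `𝓕f(0) = ∫ f dμ𝔤`.  (The step every use of (L-A)∕(L-B) makes
  silently: `T(𝓕f)` is only constrained when `𝓕f ∈ C_c^∞`.)
* §2 **`apply_eq_apply_indicator_mul_of_notMem_tsupport`** — a functional `T` on `C_c^∞(X)` (additive, homogeneous) with `T f = 0` whenever `x₀ ∉ supp f`
  is `c·δ_{x₀}`, `c = T(1_{K₀})` for any compact open `K₀ ∋ x₀` [HarishChandra1999, Thm. 3.9 (the orbit `{0}`)] (`X` Hausdorff; `f − f(x₀)·1_{K₀ ∩ f⁻¹{f x₀}}`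
  vanishes near `x₀`).
* §3 **`nilpotentFourierRegular_of_pointSupport`** — THE `δ₀`-PART OF (L-B_GL), every `N`, in the socket's currency (`subsig_K2E3GLnNilpotentFourierRegular` of
  `K2/K2E3-p12/g2/SUBSIGS-U12d-LieCore.v2`, = hypothesis `hBGL` of ★ `normalizedCharBddOnCayleySlice_of_lieCore`): if `T` is additive and homogeneous on
  `C_c^∞(𝔤𝔩_N(F))` and `T f = 0` whenever `0 ∉ supp f`, then `F_T :=` the constant `T(1_{𝒪^{N×N}})` is locally integrable, represents `T̂`
  (`T(𝓕f) = ∫ f·F_T dμ𝔤`), is locally constant, and `√|disc χ_X|_F·|F_T X|` is bounded on every compact `C` (★ `continuous_discr_charpoly`, ★ `continuous_normAbs`).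
* §4 **`gl1_nilpotentFourierRegular`** — (L-B_GL) VERBATIM AT `N = 1` (the socket's statement with `N := 1`, all hypotheses kept): a nilpotent `1 × 1` matrix
  over a field is `0` (`Matrix.isNilpotent_trace_of_isNilpotent`), so `J(𝒩) = ℂ·δ₀` and §3 applies.  First rung of the (L-B) column; count-neutral (the hosted
  socket quantifies every `N`).
[HarishChandra1999AdmissibleDistributions, Thm. 3.9, Thm. 4.4 p. 11, §21 p. 87] [Howe1974, Prop. 3] [WeilBNT1967, Ch. VII §2 Prop. 2].
HONEST LABEL: HC_CM is proved only modulo the 7 printed citations (2 remaining named inputs: hLiu418 = stmt-HodgeConjecture-24832, h413 =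
stmt-HodgeConjecture-24833) until rung 0 closes; (L-B_GL) for `N ≥ 2` (the regular and subregular nilpotent orbits) is NOT proved here.

## References
* [HarishChandra1999AdmissibleDistributions] Harish-Chandra (notes by S. DeBacker and P. J. Sally, Jr.), *Admissible Invariant Distributions on Reductive p-adic
  Groups*, AMS University Lecture Series 16 (1999), Thm. 3.9, Cor. 3.10, Thm. 4.4, §21.
* [Howe1974] R. Howe, *The Fourier transform and germs of characters (case of GL_n over a p-adic field)*, Math. Ann. 208 (1974), 305–322, Prop. 3.
* [WeilBNT1967] A. Weil, *Basic Number Theory*, Grundlehren 144 (1967), Ch. VII §2, Prop. 2.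
-/

set_option autoImplicit false
set_option linter.dupNamespace false   -- `Summit.HodgeConjecture.HodgeConjecture.…` (D-0017 nested layout; lakefile exemption for Summits)

noncomputable section

open MeasureTheory Filter Topology Polynomial
open scoped Matrix MatrixGroups NNReal
open Literature.NumberTheory.Rogawski1990 Literature.NumberTheory.Automorphic
open Literature.NumberTheory.GaloisRepresentations Literature.NumberTheory.GaloisRepresentations.IsNonarchimedeanLocalField

namespace Summit.HodgeConjecture.HodgeConjecture.Cruxes.H413.K2E3GLnNilpotentFourierPointSupport

/-! ## §1  The Fourier transform preserves `C_c^∞(𝔤𝔩_N(F))` -/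

section Fourier

variable {F : Type*} [Field F] [ValuativeRel F] [TopologicalSpace F] [IsNonarchimedeanLocalField F] {N : ℕ}

omit [ValuativeRel F] [TopologicalSpace F] [IsNonarchimedeanLocalField F] in
/-- `tr(Y X) = Σ_{(i,j)} X_{ij} Y_{ji} = ⟨vec X, vec Yᵀ⟩` — the trace form is the standard pairing on `F^{N×N}`. [cite: HarishChandra1999AdmissibleDistributions, §4 p. 11] -/
theorem trace_mul_eq_dotProduct (Y X : Matrix (Fin N) (Fin N) F) :
    Matrix.trace (Y * X) = (fun p : Fin N × Fin N => X p.1 p.2) ⬝ᵥ (fun p : Fin N × Fin N => Y p.2 p.1) := by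
  simp only [Matrix.trace, Matrix.diag_apply, Matrix.mul_apply, dotProduct, Fintype.sum_prod_type]
  rw [Finset.sum_comm]
  exact Finset.sum_congr rfl fun i _ => Finset.sum_congr rfl fun j _ => mul_comm _ _

omit [ValuativeRel F] [TopologicalSpace F] [IsNonarchimedeanLocalField F] in
/-- `𝓕f(0) = ∫ f dμ𝔤` (`ψ(0) = 1`). [cite: HarishChandra1999AdmissibleDistributions, §4 p. 11] -/
theorem matrixFourier_apply_zero (ψ : AddChar F Circle) [MeasurableSpace (Matrix (Fin N) (Fin N) F)] (μ𝔤 : Measure (Matrix (Fin N) (Fin N) F))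
    (f : Matrix (Fin N) (Fin N) F → ℂ) :
    ∫ X, ((ψ (Matrix.trace ((0 : Matrix (Fin N) (Fin N) F) * X)) : Circle) : ℂ) * f X ∂μ𝔤 = ∫ X, f X ∂μ𝔤 := by
  simp only [zero_mul, Matrix.trace_zero, AddChar.map_zero_eq_one, Circle.coe_one, one_mul]

set_option maxHeartbeats 800000 in
/-- **The Fourier transform `𝓕f(Y) = ∫ ψ(tr(YX)) f(X) dμ𝔤` maps `C_c^∞(𝔤𝔩_N(F))` to itself** (`ψ` continuous non-trivial, `μ𝔤` any left-invariant Borel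
measure): transport of ★ `piFourierSB_mem_schwartzBruhat` (Weil's Prop. 2 on `F^ι`, `ι = N × N`) along the homeomorphism `vec : X ↦ (X_{ij})_{(i,j)}`, under which
`μ𝔤` becomes a left-invariant Borel measure on `F^{N×N}` and `𝓕f = (vec f)^ ∘ vec ∘ ᵀ`. [cite: WeilBNT1967, Ch. VII §2, Prop. 2] [cite: HarishChandra1999AdmissibleDistributions, §4 p. 11] -/
theorem isLocSmooth_matrixFourier {ψ : AddChar F Circle} (hψ : ψ.IsContinuousNontrivial)
    [MeasurableSpace (Matrix (Fin N) (Fin N) F)] [BorelSpace (Matrix (Fin N) (Fin N) F)] (μ𝔤 : Measure (Matrix (Fin N) (Fin N) F)) [μ𝔤.IsAddLeftInvariant]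
    {f : Matrix (Fin N) (Fin N) F → ℂ} (hf : IsLocSmooth f) :
    IsLocSmooth fun Y : Matrix (Fin N) (Fin N) F => ∫ X, ((ψ (Matrix.trace (Y * X)) : Circle) : ℂ) * f X ∂μ𝔤 := by
  classical
  -- the two homeomorphisms `vec` and `vec ∘ transpose`
  let e : Matrix (Fin N) (Fin N) F ≃ₜ (Fin N × Fin N → F) :=
    { toFun := fun X p => X p.1 p.2
      invFun := fun x => Matrix.of fun i j => x (i, j)
      left_inv := fun X => by ext i j; rfl
      right_inv := fun x => by funext p; rfl
      continuous_toFun := continuous_pi fun p => continuous_id.matrix_elem p.1 p.2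
      continuous_invFun := continuous_matrix fun i j => continuous_apply (i, j) }
  let τ : Matrix (Fin N) (Fin N) F ≃ₜ (Fin N × Fin N → F) :=
    { toFun := fun X p => X p.2 p.1
      invFun := fun x => Matrix.of fun i j => x (j, i)
      left_inv := fun X => by ext i j; rfl
      right_inv := fun x => by funext p; rfl
      continuous_toFun := continuous_pi fun p => continuous_id.matrix_elem p.2 p.1
      continuous_invFun := continuous_matrix fun i j => continuous_apply (j, i) }
  have headd : ∀ X Y : Matrix (Fin N) (Fin N) F, e (X + Y) = e X + e Y := fun X Y => rfl
  -- the transported measurable structure on `F^{N×N}` is Borel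
  letI mPi : MeasurableSpace (Fin N × Fin N → F) := MeasurableSpace.comap e.symm ‹MeasurableSpace (Matrix (Fin N) (Fin N) F)›
  let em : Matrix (Fin N) (Fin N) F ≃ᵐ (Fin N × Fin N → F) :=
    { toEquiv := e.toEquiv
      measurable_toFun := by
        refine measurable_iff_comap_le.2 (le_of_eq ?_)
        rw [MeasurableSpace.comap_comp]
        convert MeasurableSpace.comap_id using 2
        funext X
        exact e.symm_apply_apply X
      measurable_invFun := measurable_iff_comap_le.2 le_rfl }
  haveI : BorelSpace (Fin N × Fin N → F) := em.symm.measurableEmbedding.borelSpace e.symm.isInducing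
  -- the transported measure is left-invariant
  set ν : Measure (Fin N × Fin N → F) := μ𝔤.map em with hν
  haveI : ν.IsAddLeftInvariant := by
    have h := isAddLeftInvariant_map (μ := μ𝔤) (⟨e, headd⟩ : AddHom (Matrix (Fin N) (Fin N) F) (Fin N × Fin N → F)) em.measurable e.surjective
    exact h
  -- `𝓕f = (vec f)^ ∘ τ`
  have hΦ : (f ∘ em.symm) ∈ SchwartzBruhat (Fin N × Fin N → F) :=
    (mem_schwartzBruhat_iff).2 ⟨hf.1.comp_continuous e.symm.continuous, hf.2.comp_homeomorph e.symm⟩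
  have hkey : (fun Y : Matrix (Fin N) (Fin N) F => ∫ X, ((ψ (Matrix.trace (Y * X)) : Circle) : ℂ) * f X ∂μ𝔤) =
      (piFourierSB ψ ν (f ∘ em.symm)) ∘ τ := by
    funext Y
    simp only [Function.comp_apply, piFourierSB_apply, hν]
    rw [integral_map_equiv]
    refine integral_congr_ae (Eventually.of_forall fun X => ?_)
    simp only [MeasurableEquiv.symm_apply_apply, trace_mul_eq_dotProduct]
    rfl
  rw [hkey]
  have hsb := piFourierSB_mem_schwartzBruhat ν hψ hΦ
  rw [mem_schwartzBruhat_iff] at hsb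
  exact ⟨hsb.1.comp_continuous τ.continuous, hsb.2.comp_homeomorph τ⟩

end Fourier

/-! ## §2  Point-supported functionals on `C_c^∞(X)` are multiples of `δ_{x₀}` -/

section PointSupport

variable {X : Type*} [TopologicalSpace X] [T2Space X]

/-- **A functional on `C_c^∞(X)` supported at the point `x₀` is `c·δ_{x₀}`** (`X` Hausdorff, `K₀ ∋ x₀` compact open; `T` additive and homogeneous on `C_c^∞`,
`T f = 0` whenever `x₀ ∉ supp f`): `T f = T(1_{K₀})·f(x₀)`.  Proof: with `K₁ = K₀ ∩ f⁻¹{f(x₀)}` (compact open, `∋ x₀`), both `f − f(x₀)·1_{K₁}` and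
`1_{K₀} − 1_{K₁}` vanish on `K₁`.  The orbit `{0}` of Harish-Chandra's `J(𝒩)` (`μ_{{0}} = δ₀`). [cite: HarishChandra1999AdmissibleDistributions, Thm. 3.9, Cor. 3.10 p. 10] -/
theorem apply_eq_apply_indicator_mul_of_notMem_tsupport {x₀ : X} {K₀ : Set X} (hK₀o : IsOpen K₀) (hK₀c : IsCompact K₀) (hx₀ : x₀ ∈ K₀)
    (T : (X → ℂ) → ℂ)
    (hadd : ∀ f₁ f₂ : X → ℂ, IsLocSmooth f₁ → IsLocSmooth f₂ → T (f₁ + f₂) = T f₁ + T f₂)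
    (hsmul : ∀ (a : ℂ) (f : X → ℂ), IsLocSmooth f → T (a • f) = a * T f)
    (h0 : ∀ f : X → ℂ, IsLocSmooth f → x₀ ∉ tsupport f → T f = 0)
    {f : X → ℂ} (hf : IsLocSmooth f) :
    T f = T (K₀.indicator fun _ => (1 : ℂ)) * f x₀ := by
  -- the compact open `K₁ = K₀ ∩ f⁻¹{f x₀} ∋ x₀`, on which `f ≡ f x₀`
  set K₁ : Set X := K₀ ∩ f ⁻¹' {f x₀} with hK₁
  have hK₁o : IsOpen K₁ := hK₀o.inter (hf.1.isOpen_fiber _)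
  have hK₁c : IsCompact K₁ := hK₀c.inter_right (hf.1.isClosed_fiber _)
  have hx₁ : x₀ ∈ K₁ := ⟨hx₀, rfl⟩
  have h1K₀ : IsLocSmooth (K₀.indicator fun _ => (1 : ℂ)) := isLocSmooth_indicator hK₀o hK₀c.isClosed hK₀c
  have h1K₁ : IsLocSmooth (K₁.indicator fun _ => (1 : ℂ)) := isLocSmooth_indicator hK₁o hK₁c.isClosed hK₁c
  -- a function vanishing on `K₁` has `x₀ ∉ tsupport`
  have hvan : ∀ g : X → ℂ, (∀ y ∈ K₁, g y = 0) → x₀ ∉ tsupport g := fun g hg =>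
    notMem_tsupport_iff_eventuallyEq.2 (Filter.eventually_of_mem (hK₁o.mem_nhds hx₁) hg)
  -- (a) `T 1_{K₀} = T 1_{K₁}`
  have ha : T (K₀.indicator fun _ => (1 : ℂ)) = T (K₁.indicator fun _ => (1 : ℂ)) := by
    have hsplit : (K₀.indicator fun _ => (1 : ℂ)) = ((K₀.indicator fun _ => (1 : ℂ)) - K₁.indicator fun _ => (1 : ℂ)) + K₁.indicator fun _ => (1 : ℂ) :=
      (sub_add_cancel _ _).symm
    conv_lhs => rw [hsplit]
    rw [hadd _ _ (h1K₀.sub h1K₁) h1K₁, h0 _ (h1K₀.sub h1K₁) (hvan _ fun y hy => ?_), zero_add]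
    simp only [Pi.sub_apply, Set.indicator_of_mem hy.1, Set.indicator_of_mem hy, sub_self]
  -- (b) `T f = f(x₀)·T 1_{K₁}`
  have hb : T f = f x₀ * T (K₁.indicator fun _ => (1 : ℂ)) := by
    have hsplit : f = (f - f x₀ • K₁.indicator fun _ => (1 : ℂ)) + f x₀ • K₁.indicator fun _ => (1 : ℂ) := (sub_add_cancel _ _).symm
    conv_lhs => rw [hsplit]
    rw [hadd _ _ (hf.sub (h1K₁.const_smul _)) (h1K₁.const_smul _), h0 _ (hf.sub (h1K₁.const_smul _)) (hvan _ fun y hy => ?_), zero_add,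
      hsmul _ _ h1K₁]
    have hy2 : f y = f x₀ := hy.2
    simp only [Pi.sub_apply, Pi.smul_apply, Set.indicator_of_mem hy, smul_eq_mul, mul_one, hy2, sub_self]
  rw [hb, ha, mul_comm]

end PointSupport

/-! ## §3  The `δ₀`-part of (L-B_GL), every `N` -/

section DeltaPart

variable {F : Type*} [Field F] [ValuativeRel F] [TopologicalSpace F] [IsNonarchimedeanLocalField F] {N : ℕ}

/-- The integer box `{X | X_{ij} ∈ 𝒪}` of `𝔤𝔩_N(F)` is a compact open neighbourhood of `0` (★ `isOpen∕isCompact_primePowBall`). [cite: WeilBNT1967, Ch. II §2, Def. 2] -/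
theorem isOpen_isCompact_matrixIntegerBox :
    IsOpen {X : Matrix (Fin N) (Fin N) F | ∀ i j, X i j ∈ primePowBall F 0} ∧ IsCompact {X : Matrix (Fin N) (Fin N) F | ∀ i j, X i j ∈ primePowBall F 0} ∧
      (0 : Matrix (Fin N) (Fin N) F) ∈ {X : Matrix (Fin N) (Fin N) F | ∀ i j, X i j ∈ primePowBall F 0} := by
  refine ⟨?_, ?_, fun i j => zero_mem_primePowBall 0⟩
  · simp only [Set.setOf_forall]
    exact isOpen_iInter_of_finite fun i => isOpen_iInter_of_finite fun j =>
      (isOpen_primePowBall 0).preimage (continuous_id.matrix_elem i j)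
  · -- the box is the image under the homeomorphism `Matrix.of` of the compact box `Π_i Π_j 𝒪` of `Fin N → Fin N → F`
    have h2 : IsCompact (Set.univ.pi fun _ : Fin N => Set.univ.pi fun _ : Fin N => primePowBall F 0 : Set (Fin N → Fin N → F)) :=
      isCompact_univ_pi fun _ => isCompact_univ_pi fun _ => isCompact_primePowBall 0
    have h3 := h2.image (show Continuous (Matrix.of : (Fin N → Fin N → F) → Matrix (Fin N) (Fin N) F) from
      continuous_matrix fun i j => (continuous_apply j).comp (continuous_apply i))
    refine (congrArg IsCompact ?_).mp h3
    ext X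
    refine ⟨?_, fun hX => ⟨Matrix.of.symm X, Set.mem_univ_pi.2 fun i => Set.mem_univ_pi.2 fun j => hX i j, Matrix.of.apply_symm_apply X⟩⟩
    rintro ⟨x, hx, rfl⟩
    exact fun i j => Set.mem_univ_pi.1 (Set.mem_univ_pi.1 hx i) j

set_option maxHeartbeats 800000 in
/-- **The `δ₀`-part of (L-B_GL) «Thm. 4.4 ∕ §21 for `J(𝒩)` on `𝔤𝔩_N(F)`», every `N`** (socket currency of `subsig_K2E3GLnNilpotentFourierRegular` = hypothesis `hBGL`
of ★ `normalizedCharBddOnCayleySlice_of_lieCore`, with the support condition strengthened from `𝒩` to `{0}`): for `T` additive and homogeneous on `C_c^∞(𝔤𝔩_N(F))`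
with `T f = 0` whenever `0 ∉ supp f`, the CONSTANT function `F_T ≡ c := T(1_{𝒪^{N×N}})` is locally integrable, represents the Fourier transform of `T`
(`T(𝓕f) = c·𝓕f(0) = ∫ f·c dμ𝔤`, §§1–2), is locally constant, and `√|disc χ_X|_F·|c|` is bounded on every compact `C` (continuity of `X ↦ |disc χ_X|_F`,
★ `continuous_discr_charpoly` + ★ `continuous_normAbs`).  This is the contribution of the orbit `{0}` (`μ̂_{{0}} = δ̂₀ = 1`) to Harish-Chandra's theorem.
[cite: HarishChandra1999AdmissibleDistributions, Thm. 4.4 p. 11, Thm. 3.9 p. 10, §21 p. 87] [cite: Howe1974, Prop. 3] -/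
theorem nilpotentFourierRegular_of_pointSupport {ψ : AddChar F Circle} (hψ : ψ.IsContinuousNontrivial)
    [MeasurableSpace (Matrix (Fin N) (Fin N) F)] [BorelSpace (Matrix (Fin N) (Fin N) F)] (μ𝔤 : Measure (Matrix (Fin N) (Fin N) F)) [μ𝔤.IsAddHaarMeasure]
    (T : (Matrix (Fin N) (Fin N) F → ℂ) → ℂ)
    (hadd : ∀ f₁ f₂ : Matrix (Fin N) (Fin N) F → ℂ, IsLocSmooth f₁ → IsLocSmooth f₂ → T (f₁ + f₂) = T f₁ + T f₂)
    (hsmul : ∀ (a : ℂ) (f : Matrix (Fin N) (Fin N) F → ℂ), IsLocSmooth f → T (a • f) = a * T f)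
    (h0 : ∀ f : Matrix (Fin N) (Fin N) F → ℂ, IsLocSmooth f → (0 : Matrix (Fin N) (Fin N) F) ∉ tsupport f → T f = 0) :
    ∃ Fn : Matrix (Fin N) (Fin N) F → ℂ, LocallyIntegrable Fn μ𝔤 ∧
      (∀ f : Matrix (Fin N) (Fin N) F → ℂ, IsLocSmooth f →
          T (fun Y => ∫ X, ((ψ (Matrix.trace (Y * X)) : Circle) : ℂ) * f X ∂μ𝔤) = ∫ X, f X * Fn X ∂μ𝔤) ∧
      (∀ X : Matrix (Fin N) (Fin N) F, IsUnit X.charpoly.discr → ∀ᶠ Y in 𝓝 X, Fn Y = Fn X) ∧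
      (∀ C : Set (Matrix (Fin N) (Fin N) F), IsCompact C → ∃ B : ℝ, ∀ X ∈ C,
          ((NNReal.sqrt (normAbs F X.charpoly.discr) : ℝ≥0) : ℝ) * ‖Fn X‖ ≤ B) := by
  classical
  haveI : T2Space F := (isLocalField F).toT2Space
  haveI : LocallyCompactSpace F := (isLocalField F).toLocallyCompactSpace
  haveI : LocallyCompactSpace (Matrix (Fin N) (Fin N) F) := Pi.locallyCompactSpace_of_finite
  obtain ⟨hKo, hKc, hK0⟩ := isOpen_isCompact_matrixIntegerBox (F := F) (N := N)
  set c : ℂ := T ({X : Matrix (Fin N) (Fin N) F | ∀ i j, X i j ∈ primePowBall F 0}.indicator fun _ => (1 : ℂ)) with hc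
  refine ⟨fun _ => c, locallyIntegrable_const c, fun f hf => ?_, fun X _ => Eventually.of_forall fun Y => rfl, fun C hC => ?_⟩
  · rw [apply_eq_apply_indicator_mul_of_notMem_tsupport hKo hKc hK0 T hadd hsmul h0 (isLocSmooth_matrixFourier hψ μ𝔤 hf),
      matrixFourier_apply_zero, integral_mul_const, mul_comm]
  · have hcont : Continuous fun X : Matrix (Fin N) (Fin N) F => ((NNReal.sqrt (normAbs F X.charpoly.discr) : ℝ≥0) : ℝ) * ‖c‖ :=
      (NNReal.continuous_coe.comp (NNReal.continuous_sqrt.comp (LocalFieldHaar.continuous_normAbs.comp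
        K2E3NormalizedCharBddNearSemisimpleRegular.continuous_discr_charpoly))).mul continuous_const
    obtain ⟨B, hB⟩ := hC.bddAbove_image hcont.continuousOn
    exact ⟨B, fun X hX => hB (Set.mem_image_of_mem _ hX)⟩

end DeltaPart

/-! ## §4  (L-B_GL) outright in rank `N = 1` -/

/-- A nilpotent `1 × 1` matrix over a field is `0` (its trace `X₀₀` is nilpotent, Mathlib `Matrix.isNilpotent_trace_of_isNilpotent`). [folklore] -/
theorem eq_zero_of_isNilpotent_fin_one {F : Type*} [Field F] {X : Matrix (Fin 1) (Fin 1) F} (hX : IsNilpotent X) : X = 0 := by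
  have htr : IsNilpotent (Matrix.trace X) := Matrix.isNilpotent_trace_of_isNilpotent hX
  have h00 : X 0 0 = 0 := by simpa [Matrix.trace, Fin.sum_univ_one] using htr.eq_zero
  ext i j
  rw [Subsingleton.elim i 0, Subsingleton.elim j 0, h00, Matrix.zero_apply]

set_option maxHeartbeats 800000 in
/-- **(L-B_GL) «Harish-Chandra's Thm. 4.4 ∕ §21 for `J(𝒩)` on `𝔤𝔩_N(F)`» IN RANK `N = 1`** — the socket statement `subsig_K2E3GLnNilpotentFourierRegular`
(`K2/K2E3-p12/g2/SUBSIGS-U12d-LieCore.v2`, = `hBGL` of ★ `normalizedCharBddOnCayleySlice_of_lieCore`) with `N := 1`, all hypotheses kept: on `𝔤𝔩₁(F) = F` the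
nilpotent cone is `{0}` (`eq_zero_of_isNilpotent_fin_one`), so every `T ∈ J(𝒩)` is point-supported and §3 gives `F_T ≡ T(1_𝒪)`.  First rung of the (L-B)
column (count-neutral: the hosted socket quantifies every `N`). [cite: HarishChandra1999AdmissibleDistributions, Thm. 4.4 p. 11, §21 p. 87] [cite: Howe1974, Prop. 3] -/
theorem gl1_nilpotentFourierRegular :
    ∀ (F : Type) [Field F] [ValuativeRel F] [TopologicalSpace F] [IsNonarchimedeanLocalField F] [CharZero F]
      (ψ : AddChar F Circle), ψ.IsContinuousNontrivial →
      ∀ [MeasurableSpace (Matrix (Fin 1) (Fin 1) F)] [BorelSpace (Matrix (Fin 1) (Fin 1) F)] (μ𝔤 : Measure (Matrix (Fin 1) (Fin 1) F)) [μ𝔤.IsAddHaarMeasure],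
      ∀ T : (Matrix (Fin 1) (Fin 1) F → ℂ) → ℂ,
        ((∀ f₁ f₂ : Matrix (Fin 1) (Fin 1) F → ℂ, IsLocSmooth f₁ → IsLocSmooth f₂ → T (f₁ + f₂) = T f₁ + T f₂) ∧
         (∀ (a : ℂ) (f : Matrix (Fin 1) (Fin 1) F → ℂ), IsLocSmooth f → T (a • f) = a * T f) ∧
         (∀ (x : GL (Fin 1) F) (f : Matrix (Fin 1) (Fin 1) F → ℂ), IsLocSmooth f →
            T (fun X => f ((x : Matrix (Fin 1) (Fin 1) F) * X * ((x⁻¹ : GL (Fin 1) F) : Matrix (Fin 1) (Fin 1) F))) = T f) ∧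
         (∀ f : Matrix (Fin 1) (Fin 1) F → ℂ, IsLocSmooth f → (∀ X ∈ tsupport f, ¬ IsNilpotent X) → T f = 0)) →
        ∃ Fn : Matrix (Fin 1) (Fin 1) F → ℂ, LocallyIntegrable Fn μ𝔤 ∧
          (∀ f : Matrix (Fin 1) (Fin 1) F → ℂ, IsLocSmooth f →
              T (fun Y => ∫ X, ((ψ (Matrix.trace (Y * X)) : Circle) : ℂ) * f X ∂μ𝔤) = ∫ X, f X * Fn X ∂μ𝔤) ∧
          (∀ X : Matrix (Fin 1) (Fin 1) F, IsUnit X.charpoly.discr → ∀ᶠ Y in 𝓝 X, Fn Y = Fn X) ∧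
          (∀ C : Set (Matrix (Fin 1) (Fin 1) F), IsCompact C → ∃ B : ℝ, ∀ X ∈ C,
              ((NNReal.sqrt (normAbs F X.charpoly.discr) : ℝ≥0) : ℝ) * ‖Fn X‖ ≤ B) := by
  intro F _ _ _ _ _ ψ hψ _ _ μ𝔤 _ T hT
  obtain ⟨hadd, hsmul, -, hnil⟩ := hT
  refine nilpotentFourierRegular_of_pointSupport hψ μ𝔤 T hadd hsmul fun f hf h0 => hnil f hf fun X hX hXn => h0 ?_
  rwa [eq_zero_of_isNilpotent_fin_one hXn] at hX

end Summit.HodgeConjecture.HodgeConjecture.Cruxes.H413.K2E3GLnNilpotentFourierPointSupport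

end
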